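import Mathlib.Geometry.Manifold.Instances.Real
import Mathlib.Geometry.Manifold.VectorBundle.Tangent
import Mathlib.Geometry.Manifold.MFDeriv.Tangent
import Mathlib.Geometry.Manifold.MFDeriv.Atlas
import Mathlib.Geometry.Manifold.ContMDiff.Atlas
import Mathlib.Geometry.Manifold.ContMDiff.NormedSpace
import Mathlib.Geometry.Manifold.ContMDiffMFDeriv
import Mathlib.Analysis.InnerProductSpace.PiL2
import Mathlib.Analysis.Complex.Basic

/-!
# Chart localisation of `J`-holomorphic maps

Crux `WitnessCharge` (item stmt-SmoothPoincare4-7824, route route-SmoothPoincare4-SullivanDual,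
crux `Summit.SmoothPoincare4.SmoothPoincare4.Theses.SullivanDual.WitnessCharge`), line `Sketch`,
stubs `helper_jHolomorphic_chart`, `helper_jHolomorphic_of_chart`, `helper_contMDiffAt_of_chart`
((P5): passing `J`-holomorphic maps `u : ℂ → M` to their chart expressions and back).

Let `M` be a `C^∞` manifold modelled on `ℝ⁴`, `J` a field of endomorphisms of its tangent spaces,
`x₀ : M`, `φ₀ = extChartAt (𝓡 4) x₀` and `u : ℂ → M` smooth at `z` with `u z` in the chart
source. Write `A = mfderiv φ₀ (u z)` and `B = mfderivWithin (range (𝓡 4)) φ₀.symm (φ₀ (u z))`;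
then `B ∘ A = id` (`mfderivWithin_extChartAt_symm_comp_mfderiv_extChartAt'`), the frame
expression of `J` at `u z` is `Jin (u z) = A ∘ J (u z) ∘ B` (`inTangentCoordinates_eq_mfderiv_comp`)
and `D(φ₀ ∘ u)(z) = A ∘ du(z)` (chain rule for `mfderiv`, `mfderiv = fderiv` between vector
spaces). Hence `du(z)(iζ) = J (du(z) ζ)` for all `ζ` iff `D(φ₀ ∘ u)(z)(iζ) = Jin (u z) (D(φ₀ ∘ u)(z) ζ)`
for all `ζ` (`A` is injective, being left-invertible). Finally smoothness of `u` at `z` is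
smoothness of `φ₀ ∘ u` at `z` plus continuity (`contMDiffAt_iff_target_of_mem_source`).
-/

noncomputable section

set_option linter.dupNamespace false

open scoped Manifold ContDiff Topology
open Set Filter

namespace Summit.SmoothPoincare4.SmoothPoincare4.Theorems.WitnessCharge.PencilIncompleteness

section ChartCalculus

variable {M : Type*} [TopologicalSpace M] [ChartedSpace (EuclideanSpace ℝ (Fin 4)) M]
  [IsManifold (𝓡 4) ∞ M]

/-- Chain rule in a chart: for `u : ℂ → M` smooth at `z` with `u z` in the source of the chart at
`x₀`, the derivative of the chart expression `φ₀ ∘ u` at `z` is `mfderiv φ₀ (u z) ∘ mfderiv u z`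
(`HasMFDerivAt.comp`, `mfderiv_eq_fderiv`). [folklore] -/
theorem fderiv_extChartAt_comp_apply {x₀ : M} {u : ℂ → M} {z : ℂ}
    (hu : ContMDiffAt 𝓘(ℝ, ℂ) (𝓡 4) ∞ u z)
    (hz : u z ∈ (chartAt (EuclideanSpace ℝ (Fin 4)) x₀).source) (v : ℂ) :
    fderiv ℝ (fun w : ℂ => extChartAt (𝓡 4) x₀ (u w)) z v =
      mfderiv (𝓡 4) 𝓘(ℝ, EuclideanSpace ℝ (Fin 4)) (extChartAt (𝓡 4) x₀) (u z)
        (mfderiv 𝓘(ℝ, ℂ) (𝓡 4) u z v) := by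
  have h := ((mdifferentiableAt_extChartAt (I := 𝓡 4) hz).hasMFDerivAt.comp z
    ((hu.mdifferentiableAt (by simp)).hasMFDerivAt)).mfderiv
  rw [mfderiv_eq_fderiv] at h
  exact DFunLike.congr_fun h v

/-- The frame expression of `J` at a point `x` of the chart source, applied to a vector:
`Jin x v = A (J x (B v))` with `A = mfderiv φ₀ x`, `B = mfderivWithin (range (𝓡 4)) φ₀.symm (φ₀ x)`
(`inTangentCoordinates_eq_mfderiv_comp`). [folklore] -/
theorem inTangentCoordinates_id_apply
    (J : ∀ x : M, TangentSpace (𝓡 4) x →L[ℝ] TangentSpace (𝓡 4) x) {x₀ x : M}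
    (hx : x ∈ (chartAt (EuclideanSpace ℝ (Fin 4)) x₀).source) (v : EuclideanSpace ℝ (Fin 4)) :
    inTangentCoordinates (𝓡 4) (𝓡 4) (id : M → M) id (fun x => J x) x₀ x v =
      mfderiv (𝓡 4) 𝓘(ℝ, EuclideanSpace ℝ (Fin 4)) (extChartAt (𝓡 4) x₀) x
        (J x (mfderivWithin 𝓘(ℝ, EuclideanSpace ℝ (Fin 4)) (𝓡 4) (extChartAt (𝓡 4) x₀).symm
          (range (𝓡 4)) (extChartAt (𝓡 4) x₀ x) v)) := by
  have h := inTangentCoordinates_eq_mfderiv_comp (I := 𝓡 4) (I' := 𝓡 4) (f := (id : M → M))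
    (g := (id : M → M)) (ϕ := fun x => J x) (x₀ := x₀) (x := x) hx hx
  exact DFunLike.congr_fun h v

/-- `B (A v) = v` for `A = mfderiv φ₀ x`, `B = mfderivWithin (range (𝓡 4)) φ₀.symm (φ₀ x)` and
`x` in the chart source (`mfderivWithin_extChartAt_symm_comp_mfderiv_extChartAt'`). [folklore] -/
theorem mfderivWithin_extChartAt_symm_apply_mfderiv_extChartAt {x₀ x : M}
    (hx : x ∈ (chartAt (EuclideanSpace ℝ (Fin 4)) x₀).source) (v : TangentSpace (𝓡 4) x) :
    mfderivWithin 𝓘(ℝ, EuclideanSpace ℝ (Fin 4)) (𝓡 4) (extChartAt (𝓡 4) x₀).symm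
        (range (𝓡 4)) (extChartAt (𝓡 4) x₀ x)
      (mfderiv (𝓡 4) 𝓘(ℝ, EuclideanSpace ℝ (Fin 4)) (extChartAt (𝓡 4) x₀) x v) = v := by
  have hx' : x ∈ (extChartAt (𝓡 4) x₀).source := by rwa [extChartAt_source]
  exact DFunLike.congr_fun (mfderivWithin_extChartAt_symm_comp_mfderiv_extChartAt' hx') v

/-- `A = mfderiv φ₀ x` is injective for `x` in the chart source (it has the left inverse `B`).
[folklore] -/
theorem mfderiv_extChartAt_injective {x₀ x : M}
    (hx : x ∈ (chartAt (EuclideanSpace ℝ (Fin 4)) x₀).source) :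
    Function.Injective
      (mfderiv (𝓡 4) 𝓘(ℝ, EuclideanSpace ℝ (Fin 4)) (extChartAt (𝓡 4) x₀) x) := by
  intro v w hvw
  rw [← mfderivWithin_extChartAt_symm_apply_mfderiv_extChartAt hx v,
    ← mfderivWithin_extChartAt_symm_apply_mfderiv_extChartAt hx w, hvw]

end ChartCalculus

/-- R4a: a `J`-holomorphic map is flat-holomorphic in a chart for the coordinate expression of
`J`: if `du(z)(iζ) = J (du(z) ζ)` and `u z` lies in the source of the chart `φ₀` at `x₀`, then
`D(φ₀ ∘ u)(z)(iζ) = Jin (u z) (D(φ₀ ∘ u)(z) ζ)` where `Jin` is the frame expression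
`inTangentCoordinates` of `J`. Proof: `D(φ₀ ∘ u)(z) = A ∘ du(z)`, `Jin (u z) = A ∘ J ∘ B` and
`B ∘ A = id` with `A = mfderiv φ₀ (u z)`. [folklore] -/
theorem helper_jHolomorphic_chart :
    ∀ (M : Type) [TopologicalSpace M] [ChartedSpace (EuclideanSpace ℝ (Fin 4)) M]
      [IsManifold (𝓡 4) ∞ M]
      (J : ∀ x : M, TangentSpace (𝓡 4) x →L[ℝ] TangentSpace (𝓡 4) x) (x₀ : M) (u : ℂ → M) (z : ℂ),
      ContMDiffAt 𝓘(ℝ, ℂ) (𝓡 4) ∞ u z →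
      (∀ ζ : ℂ, mfderiv 𝓘(ℝ, ℂ) (𝓡 4) u z (Complex.I * ζ : ℂ) = J (u z) (mfderiv 𝓘(ℝ, ℂ) (𝓡 4) u z (ζ : ℂ))) →
      u z ∈ (chartAt (EuclideanSpace ℝ (Fin 4)) x₀).source →
      ∀ ζ : ℂ, fderiv ℝ (fun w : ℂ => extChartAt (𝓡 4) x₀ (u w)) z (Complex.I * ζ) =
        inTangentCoordinates (𝓡 4) (𝓡 4) (id : M → M) id (fun x => J x) x₀ (u z)
          (fderiv ℝ (fun w : ℂ => extChartAt (𝓡 4) x₀ (u w)) z ζ) := by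
  intro M _ _ _ J x₀ u z hu hhol hz ζ
  rw [fderiv_extChartAt_comp_apply hu hz, fderiv_extChartAt_comp_apply hu hz,
    inTangentCoordinates_id_apply J hz, mfderivWithin_extChartAt_symm_apply_mfderiv_extChartAt hz,
    hhol ζ]

/-- R4b: conversely, flat-holomorphy of the chart expression gives `J`-holomorphy: if
`D(φ₀ ∘ u)(z)(iζ) = Jin (u z) (D(φ₀ ∘ u)(z) ζ)` for all `ζ` and `u z` lies in the chart source,
then `du(z)(iζ) = J (du(z) ζ)`. Proof: both sides agree after applying the injective map
`A = mfderiv φ₀ (u z)`, by the chain rule, `Jin (u z) = A ∘ J ∘ B` and `B ∘ A = id`.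
[folklore] -/
theorem helper_jHolomorphic_of_chart :
    ∀ (M : Type) [TopologicalSpace M] [ChartedSpace (EuclideanSpace ℝ (Fin 4)) M]
      [IsManifold (𝓡 4) ∞ M]
      (J : ∀ x : M, TangentSpace (𝓡 4) x →L[ℝ] TangentSpace (𝓡 4) x) (x₀ : M) (u : ℂ → M) (z : ℂ),
      ContMDiffAt 𝓘(ℝ, ℂ) (𝓡 4) ∞ u z →
      u z ∈ (chartAt (EuclideanSpace ℝ (Fin 4)) x₀).source →
      (∀ ζ : ℂ, fderiv ℝ (fun w : ℂ => extChartAt (𝓡 4) x₀ (u w)) z (Complex.I * ζ) =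
        inTangentCoordinates (𝓡 4) (𝓡 4) (id : M → M) id (fun x => J x) x₀ (u z)
          (fderiv ℝ (fun w : ℂ => extChartAt (𝓡 4) x₀ (u w)) z ζ)) →
      ∀ ζ : ℂ, mfderiv 𝓘(ℝ, ℂ) (𝓡 4) u z (Complex.I * ζ : ℂ) =
        J (u z) (mfderiv 𝓘(ℝ, ℂ) (𝓡 4) u z (ζ : ℂ)) := by
  intro M _ _ _ J x₀ u z hu hz hflat ζ
  have h := hflat ζ
  rw [fderiv_extChartAt_comp_apply hu hz, fderiv_extChartAt_comp_apply hu hz,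
    inTangentCoordinates_id_apply J hz,
    mfderivWithin_extChartAt_symm_apply_mfderiv_extChartAt hz] at h
  exact mfderiv_extChartAt_injective hz h

/-- R4c: smoothness transfers from the chart expression: if `u` is continuous at `z`, `u z` lies
in the source of the chart `φ₀` at `x₀` and `φ₀ ∘ u` is `C^∞` at `z`, then `u` is `C^∞` at `z`
(`contMDiffAt_iff_target_of_mem_source`, `contMDiffAt_iff_contDiffAt`). [folklore] -/
theorem helper_contMDiffAt_of_chart :
    ∀ (M : Type) [TopologicalSpace M] [ChartedSpace (EuclideanSpace ℝ (Fin 4)) M]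
      [IsManifold (𝓡 4) ∞ M] (x₀ : M) (u : ℂ → M) (z : ℂ),
      ContinuousAt u z → u z ∈ (chartAt (EuclideanSpace ℝ (Fin 4)) x₀).source →
      ContDiffAt ℝ ∞ (fun w : ℂ => extChartAt (𝓡 4) x₀ (u w)) z →
      ContMDiffAt 𝓘(ℝ, ℂ) (𝓡 4) ∞ u z := by
  intro M _ _ _ x₀ u z hcont hz hdiff
  exact (contMDiffAt_iff_target_of_mem_source hz).2 ⟨hcont, contMDiffAt_iff_contDiffAt.2 hdiff⟩

end Summit.SmoothPoincare4.SmoothPoincare4.Theorems.WitnessCharge.PencilIncompleteness
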